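import Summits.CriticalPhenomena.Ising3DConformalLimit.Theorems.MirrorHoelderCompactnessSeparableHoelderGradient
import Summits.CriticalPhenomena.Ising3DConformalLimit.Theorems.MirrorHoelderCompactnessSeparableHoelderMirrors
import Summits.CriticalPhenomena.Ising3DConformalLimit.Theorems.MirrorHoelderCompactnessSeparableHoelderLattice
import Summits.CriticalPhenomena.Ising3DConformalLimit.Theorems.EnergyNotSigmaSquaredMoebiusLimitExistsPinnedTwoPoint
import Summits.CriticalPhenomena.Ising3DConformalLimit.Theorems.MoebiusLimitExists.Negative.PinnedClusterPoints
import Summits.CriticalPhenomena.Ising3DConformalLimit.Theorems.MoebiusLimitExists.Negative.RatioRegular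
import Summits.CriticalPhenomena.Ising3DConformalLimit.Theorems.HyperoctahedralRPExistsScaleCovariantLimitRegularityGivesPrecompact
import Summits.CriticalPhenomena.Ising3DConformalLimit.Theses.MirrorHoelderCompactness
import HarnessLib

/-!
# The lattice Hölder step for a coordinate-separated PAIR and its rescaling (helper for stub F5 of line `Sketch`,
# crux `ExistsScaleCovariantLimit`, item stmt-CriticalPhenomena-1981; registered stub `stub_pairLatticeStep`; lead c4, 2026-08-16)

Route `MirrorHoelderCompactness` landed the LATTICE Hölder estimate `sq_criticalCorr_sub_le` (one mirror-separated spin moved by a few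
lattice steps: RP–Cauchy–Schwarz, the all-direction gradient bound ADC21 Prop. 5.9 / DCP25 (1.11) with Messager–Miracle-Solé, Newman's
Gaussian inequality). This file specialises it to ORDER TWO at a COORDINATE mirror, both orientations (`stub_pairLatticeStep`: for a pair
`x` whose points are `m`-separated in coordinate `τ`, a move `xᵢ ↦ y` of size `≤ m/64` and the integer scales `q, R`,
`(⟨∏σ_X⟩ − ⟨∏σ_{X'}⟩)² ≤ (2g(4q)/(4q+1)·‖Xᵢ − X'ᵢ‖₁)(2g(R))` for the lattice approximations), and provides the rescaling by
`ρ_pin⁴ = g(⌊1/δ⌋)^{-2}` (`sq_pairZoom_sub_le`) and the floor / `ℓ¹` / scale bookkeeping (`l1Dist_latticeApprox_le_div`, `exists_two_scales`).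
The companion file `…PairMoveHoelderOfDoubling.lean` turns this into the Hölder-`1/2` modulus of the pinned pair zoom from item 6150 alone,
whence (skeleton v12) item 5955 ⟺ item 4658 ⟺ item 6150.
-- adapted in part from Theorems/MirrorHoelderCompactnessSeparableHoelderFloors.lean (route MirrorHoelderCompactness).

References: M. Aizenman, H. Duminil-Copin, Ann. Math. 194 (2021), arXiv:1912.07973, Prop. 5.9, §6.3 [AizenmanDuminilCopinAnnals2021];
J. Fröhlich, R. Israel, E. H. Lieb, B. Simon, Comm. Math. Phys. 62 (1978) §2 [FILS1978]. No definitions, no `sorry`.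
-/

noncomputable section

open Literature.Probability.LatticeModels Filter Set Function Finset
open scoped Topology BigOperators
open Summit.CriticalPhenomena.Ising3DConformalLimit.MoebiusLimitExistsOnlyInteraction (rhoPin rhoPin_sq)
open Summit.CriticalPhenomena.Ising3DConformalLimit.MirrorHoelderCompactnessSeparableHoelder
  (coordMirror le_inv_pow_mul_of_doubling_of_le)


namespace Summit.CriticalPhenomena.Ising3DConformalLimit.Cruxes.ExistsScaleCovariantLimit.TwoHierarchies

/-! ## Elementary bookkeeping -/

/-- `|⌊a⌋ − ⌊b⌋| ≤ |a − b| + 1`, real-cast form used for the `ℓ¹` length of a lattice move. [folklore] -/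
theorem abs_cast_floor_sub_floor_le (a b : ℝ) : |((⌊a⌋ : ℝ) - ⌊b⌋)| ≤ |a - b| + 1 := by
  -- adapted from …MirrorHoelderCompactnessSeparableHoelderFloors.lean `abs_floor_sub_floor_le` (route MirrorHoelderCompactness)
  have ha1 := Int.floor_le a
  have ha2 := Int.lt_floor_add_one a
  have hb1 := Int.floor_le b
  have hb2 := Int.lt_floor_add_one b
  rw [abs_le]
  constructor
  · have : -(|a - b|) ≤ a - b := neg_abs_le _
    linarith
  · have : a - b ≤ |a - b| := le_abs_self _
    linarith

/-- The `ℓ¹` length of the lattice move `[v/δ] → [v'/δ]` is at most `3(‖v − v'‖ + δ)/δ`. [folklore] -/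
theorem l1Dist_latticeApprox_le_div {δ : ℝ} (hδ : 0 < δ) (v v' : EuclideanSpace ℝ (Fin 3)) :
    (Site.l1Dist (latticeApprox δ v) (latticeApprox δ v') : ℝ) ≤ 3 * (‖v - v'‖ + δ) / δ := by
  -- adapted from …MirrorHoelderCompactnessSeparableHoelderFloors.lean `l1Dist_latticeApprox_le`
  have hk : ∀ k : Fin 3,
      (((latticeApprox δ v k - latticeApprox δ v' k).natAbs : ℕ) : ℝ) ≤ ‖v - v'‖ / δ + 1 := by
    intro k
    rw [Nat.cast_natAbs, Int.cast_abs, latticeApprox_apply, latticeApprox_apply, Int.cast_sub]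
    refine (abs_cast_floor_sub_floor_le _ _).trans ?_
    rw [← sub_div, abs_div, abs_of_pos hδ, ← PiLp.sub_apply]
    have h := PiLp.norm_apply_le (v - v') k
    rw [Real.norm_eq_abs] at h
    gcongr
  have hsum : (Site.l1Dist (latticeApprox δ v) (latticeApprox δ v') : ℝ) =
      ∑ k : Fin 3, (((latticeApprox δ v k - latticeApprox δ v' k).natAbs : ℕ) : ℝ) := by
    unfold Site.l1Dist
    push_cast
    rfl
  rw [hsum, Fin.sum_univ_three]
  have e : 3 * (‖v - v'‖ + δ) / δ = (‖v - v'‖ / δ + 1) + (‖v - v'‖ / δ + 1) + (‖v - v'‖ / δ + 1) := by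
    field_simp
    ring
  rw [e]
  exact add_le_add (add_le_add (hk 0) (hk 1)) (hk 2)

/-- **The two integer scales** `q = ⌊m/(64δ)⌋ ≥ 1` and `R = ⌊m/(2δ)⌋ − 5 ≥ 1` with `m/(32δ) ≤ 4q`, `16q ≤ m/(4δ)`,
`R + 5 ≤ m/(2δ) < R + 6`, for `0 < δ ≤ m/128`. [folklore] -/
theorem exists_two_scales {m δ : ℝ} (hm : 0 < m) (hδ0 : 0 < δ) (hδm : δ ≤ m / 128) :
    ∃ q R : ℕ, 1 ≤ q ∧ m / δ / 32 ≤ 4 * (q : ℝ) ∧ 16 * (q : ℝ) ≤ m / δ / 4 ∧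
      1 ≤ R ∧ (R : ℝ) + 5 ≤ m / δ / 2 ∧ m / δ / 2 < R + 6 := by
  -- adapted from …MirrorHoelderCompactnessSeparableHoelderFloors.lean `exists_scales` (the scales `q` and `R`, with `r₀ = m/2`)
  have ht : 128 ≤ m / δ := by rw [le_div_iff₀ hδ0]; linarith
  have hqle : ((⌊m / δ / 64⌋₊ : ℕ) : ℝ) ≤ m / δ / 64 := Nat.floor_le (by positivity)
  have hqgt : m / δ / 64 < ((⌊m / δ / 64⌋₊ : ℕ) : ℝ) + 1 := Nat.lt_floor_add_one _
  have hs : (12 : ℝ) ≤ m / δ / 2 := by linarith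
  have hF12 : 12 ≤ ⌊m / δ / 2⌋₊ := Nat.le_floor (by exact_mod_cast hs)
  have hFle : ((⌊m / δ / 2⌋₊ : ℕ) : ℝ) ≤ m / δ / 2 := Nat.floor_le (by positivity)
  have hFgt : m / δ / 2 < ((⌊m / δ / 2⌋₊ : ℕ) : ℝ) + 1 := Nat.lt_floor_add_one _
  have hRcast : (((⌊m / δ / 2⌋₊ - 5 : ℕ)) : ℝ) = ((⌊m / δ / 2⌋₊ : ℕ) : ℝ) - 5 := by
    rw [Nat.cast_sub (by omega)]; norm_num
  refine ⟨⌊m / δ / 64⌋₊, ⌊m / δ / 2⌋₊ - 5, ?_, ?_, ?_, by omega, ?_, ?_⟩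
  · have h : (1 : ℝ) < ((⌊m / δ / 64⌋₊ : ℕ) : ℝ) := by linarith
    exact_mod_cast h.le
  · linarith
  · linarith
  · rw [hRcast]; linarith
  · rw [hRcast]; linarith


/-- Lower bound for a coordinate difference of lattice approximations: `⌊a/δ⌋ − ⌊b/δ⌋ ≥ (a − b)/δ − 1`. [folklore] -/
theorem sub_div_sub_one_le_floor_sub (δ a b : ℝ) :
    (a - b) / δ - 1 ≤ ((⌊a / δ⌋ - ⌊b / δ⌋ : ℤ) : ℝ) := by
  have h1 := Int.floor_le (b / δ)
  have h2 := Int.lt_floor_add_one (a / δ)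
  rw [Int.cast_sub, sub_div]
  linarith

/-- The pinned pair zoom at a configuration and the critical pair correlator of its lattice approximation:
`F₂(δ)(x) = g(⌊1/δ⌋)⁻¹ ⟨σ_{[x₀/δ]}σ_{[x₁/δ]}⟩`. [folklore] -/
theorem pairZoom_eq (δ : ℝ) (x : Fin 2 → EuclideanSpace ℝ (Fin 3)) :
    rescaledCorrelator (criticalCorr 3) rhoPin 2 δ x =
      (criticalTwoPoint 3 (Pi.single 0 ⌊1 / δ⌋))⁻¹ * criticalCorr 3 2 (fun l => latticeApprox δ (x l)) := by
  rw [rescaledCorrelator_apply, rhoPin_sq]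

/-- A power of two above a positive real. [folklore] -/
theorem exists_pow_two_ge (t : ℝ) : ∃ J : ℕ, t ≤ (2 : ℝ) ^ J := by
  obtain ⟨J, hJ⟩ := pow_unbounded_of_one_lt t (by norm_num : (1 : ℝ) < 2)
  exact ⟨J, hJ.le⟩

/-! ## The rescaling step (orientation-free) -/

/-- **From the lattice Hölder bound to the rescaled bound.** If at mesh `δ` the lattice pair configurations `X, X'` (differing
at `i`) satisfy `(⟨∏σ_X⟩ − ⟨∏σ_{X'}⟩)² ≤ (2·g(4q)/(4q+1)·L)·(2·g(R))` with `g(4q) ≤ A g(N)`, `g(R) ≤ A g(N)`, `N = ⌊1/δ⌋ ≥ 1`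
and `L/(4q+1) ≤ c`, then `(F₂' − F₂)² ≤ 4 A² c` for the pinned pair zooms `F₂ = g(N)⁻¹⟨∏σ_X⟩`. [folklore] -/
theorem sq_pairZoom_sub_le {δ : ℝ} {X X' : Fin 2 → Site 3} {L q R : ℕ} {A c : ℝ} {N : ℕ}
    (hN : (⌊1 / δ⌋ : ℤ) = (N : ℤ))
    (hlat : (criticalCorr 3 2 X - criticalCorr 3 2 X') ^ 2 ≤
      (2 * (criticalTwoPoint 3 (Pi.single 0 ((4 * q : ℕ) : ℤ)) / (4 * (q : ℝ) + 1)) * (L : ℝ)) *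
        ((2 * 1 : ℕ).factorial * criticalTwoPoint 3 (Pi.single 0 (R : ℤ)) ^ 1))
    (ha : criticalTwoPoint 3 (Pi.single 0 ((4 * q : ℕ) : ℤ)) ≤ A * criticalTwoPoint 3 (Pi.single 0 (N : ℤ)))
    (hb : criticalTwoPoint 3 (Pi.single 0 (R : ℤ)) ≤ A * criticalTwoPoint 3 (Pi.single 0 (N : ℤ)))
    (hc : (L : ℝ) / (4 * (q : ℝ) + 1) ≤ c) :
    ((criticalTwoPoint 3 (Pi.single 0 ⌊1 / δ⌋))⁻¹ * criticalCorr 3 2 X' -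
      (criticalTwoPoint 3 (Pi.single 0 ⌊1 / δ⌋))⁻¹ * criticalCorr 3 2 X) ^ 2 ≤ 4 * A ^ 2 * c := by
  set gN := criticalTwoPoint 3 (Pi.single 0 (N : ℤ)) with hgN
  have hgNpos : 0 < gN := PinnedClusterPoints.criticalTwoPoint_pos3 _
  have hgq : 0 ≤ criticalTwoPoint 3 (Pi.single 0 ((4 * q : ℕ) : ℤ)) := criticalTwoPoint_nonneg' _
  have hgR : 0 ≤ criticalTwoPoint 3 (Pi.single 0 (R : ℤ)) := criticalTwoPoint_nonneg' _
  have hQ : 0 < 4 * (q : ℝ) + 1 := by positivity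
  have ha' : criticalTwoPoint 3 (Pi.single 0 ((4 * q : ℕ) : ℤ)) * gN⁻¹ ≤ A := by
    rw [← div_eq_mul_inv, div_le_iff₀ hgNpos]; exact ha
  have hb' : criticalTwoPoint 3 (Pi.single 0 (R : ℤ)) * gN⁻¹ ≤ A := by
    rw [← div_eq_mul_inv, div_le_iff₀ hgNpos]; exact hb
  have hfac : ((2 * 1 : ℕ).factorial : ℝ) = 2 := by norm_num
  rw [hfac] at hlat
  -- adapted from …MirrorHoelderCompactnessSeparableHoelderFloors.lean `sq_bound_assemble` (n' = 1)
  have hL : (0 : ℝ) ≤ L := Nat.cast_nonneg _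
  have e1 : 0 ≤ criticalTwoPoint 3 (Pi.single 0 ((4 * q : ℕ) : ℤ)) * gN⁻¹ := by positivity
  have e2 : 0 ≤ criticalTwoPoint 3 (Pi.single 0 (R : ℤ)) * gN⁻¹ := by positivity
  have e3 : 0 ≤ (L : ℝ) / (4 * (q : ℝ) + 1) := by positivity
  have hA0 : 0 ≤ A := e1.trans ha'
  have h : gN⁻¹ ^ (1 + 1) * (criticalCorr 3 2 X - criticalCorr 3 2 X') ^ 2 ≤ 2 * 2 * A * A * c := by
    calc gN⁻¹ ^ (1 + 1) * (criticalCorr 3 2 X - criticalCorr 3 2 X') ^ 2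
        ≤ gN⁻¹ ^ (1 + 1) * ((2 * (criticalTwoPoint 3 (Pi.single 0 ((4 * q : ℕ) : ℤ)) / (4 * (q : ℝ) + 1)) * (L : ℝ)) *
            (2 * criticalTwoPoint 3 (Pi.single 0 (R : ℤ)) ^ 1)) :=
          mul_le_mul_of_nonneg_left hlat (by positivity)
      _ = 2 * 2 * (criticalTwoPoint 3 (Pi.single 0 ((4 * q : ℕ) : ℤ)) * gN⁻¹) *
            (criticalTwoPoint 3 (Pi.single 0 (R : ℤ)) * gN⁻¹) * ((L : ℝ) / (4 * (q : ℝ) + 1)) := by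
          rw [div_eq_mul_inv, div_eq_mul_inv]
          ring
      _ ≤ 2 * 2 * A * A * c := by
          have h1 : 2 * 2 * (criticalTwoPoint 3 (Pi.single 0 ((4 * q : ℕ) : ℤ)) * gN⁻¹) ≤ 2 * 2 * A :=
            mul_le_mul_of_nonneg_left ha' (by norm_num)
          have h2 : 2 * 2 * (criticalTwoPoint 3 (Pi.single 0 ((4 * q : ℕ) : ℤ)) * gN⁻¹) *
              (criticalTwoPoint 3 (Pi.single 0 (R : ℤ)) * gN⁻¹) ≤ 2 * 2 * A * A :=
            mul_le_mul h1 hb' e2 (by positivity)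
          exact mul_le_mul h2 hc e3 (by positivity)
  rw [hN, ← hgN]
  calc (gN⁻¹ * criticalCorr 3 2 X' - gN⁻¹ * criticalCorr 3 2 X) ^ 2
      = gN⁻¹ ^ (1 + 1) * (criticalCorr 3 2 X - criticalCorr 3 2 X') ^ 2 := by ring
    _ ≤ 2 * 2 * A * A * c := h
    _ = 4 * A ^ 2 * c := by ring

/-! ## The lattice step at a coordinate-separated pair (both orientations) -/

/-- **The lattice Hölder bound at order two with a coordinate mirror** — both orientations. At mesh `δ`, for a pair `x` whose
points are separated by `m` in coordinate `τ` (`|x i τ − x j τ| ≥ m`), a move `x i ↦ y` of size `≤ h₀ ≤ m/64`, and integer scales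
`q ≥ 1`, `R` with `16q ≤ m/(4δ)`, `R + 5 ≤ m/(2δ)`, `m/δ ≥ 128`: the lattice approximations `X = [x/δ]`, `X' = [x'/δ]` satisfy
`(⟨∏σ_X⟩ − ⟨∏σ_{X'}⟩)² ≤ (2·g(4q)/(4q+1)·‖X i − X' i‖₁)·(2·g(R))` — the MHC lattice estimate `sq_criticalCorr_sub_le` (moving point below,
mirror `{V_τ = [x_jτ/δ] − R}`) or its mirrored form (moving point above, mirror `{V_τ = [x_jτ/δ] + R}`), the moving lattice point
being at level `≥ m/(2δ) + 4 ≥ 16q + 2‖X i − X' i‖₁` from the mirror and the other point exactly at level `R` beyond it.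
[cite: FILS1978, §2] -/
theorem stub_pairLatticeStep {δ m h₀ : ℝ} (hδ : 0 < δ) {x : Fin 2 → EuclideanSpace ℝ (Fin 3)} {i j : Fin 2} (hij : i ≠ j)
    {τ : Fin 3} (hsep : m ≤ |x i τ - x j τ|) {y : EuclideanSpace ℝ (Fin 3)} (hy : ‖y - x i‖ ≤ h₀)
    {q R : ℕ} (hq : 1 ≤ q) (h16q : 16 * (q : ℝ) ≤ m / δ / 4) (hR5 : (R : ℝ) + 5 ≤ m / 2 / δ)
    (hh₀ : h₀ ≤ m / 64) (hmδ : 128 ≤ m / δ) :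
    (criticalCorr 3 (1 + 1) (fun l => latticeApprox δ (x l)) -
        criticalCorr 3 (1 + 1) (fun l => latticeApprox δ (Function.update x i y l))) ^ 2 ≤
      (2 * (criticalTwoPoint 3 (Pi.single 0 ((4 * q : ℕ) : ℤ)) / (4 * (q : ℝ) + 1)) *
          Site.l1Dist (latticeApprox δ (x i)) (latticeApprox δ y)) *
        ((2 * 1 : ℕ).factorial * criticalTwoPoint 3 (Pi.single 0 (R : ℤ)) ^ 1) := by
  set X : Fin (1 + 1) → Site 3 := fun l => latticeApprox δ (x l) with hX
  set X' : Fin (1 + 1) → Site 3 := fun l => latticeApprox δ (Function.update x i y l) with hX'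
  have hXi : X i = latticeApprox δ (x i) := rfl
  have hXi' : X' i = latticeApprox δ y := by simp [hX']
  have hXj : X j = latticeApprox δ (x j) := rfl
  have hdiff : ∀ l, l ≠ i → X' l = X l := fun l hl => by simp [hX, hX', Function.update_of_ne hl]
  have hother : ∀ l : Fin (1 + 1), l ≠ i → l = j := fun l hl => by omega
  have hmpos : 0 < m := by
    have : 0 < m / δ := by linarith
    exact (div_pos_iff_of_pos_right hδ).1 this
  -- the move in coordinate `τ`, in lattice units
  have hyτ : |y τ - x i τ| ≤ h₀ := by
    have := MoebiusLimitExistsNegative.abs_apply_le_norm (y - x i) τ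
    rw [PiLp.sub_apply] at this
    exact this.trans hy
  -- the `ℓ¹` length of the lattice move
  have hL : (Site.l1Dist (X i) (X' i) : ℝ) ≤ 3 * (h₀ / δ) + 3 := by
    rw [hXi, hXi']
    refine (l1Dist_latticeApprox_le_div hδ (x i) y).trans ?_
    have h1 : 3 * (‖x i - y‖ + δ) / δ = 3 * (‖x i - y‖ / δ) + 3 := by
      field_simp
    rw [h1]
    have : ‖x i - y‖ / δ ≤ h₀ / δ := div_le_div_of_nonneg_right (by rwa [norm_sub_rev]) hδ.le
    linarith
  -- target level bound: `16q + 2L ≤ m/(2δ) + 4`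
  have hlevel : 16 * (q : ℝ) + 2 * (Site.l1Dist (X i) (X' i) : ℝ) ≤ m / δ / 2 + 4 := by
    have e1 : m / δ / 4 = (m / δ) / 4 := rfl
    have hh : h₀ / δ ≤ m / δ / 64 := by
      rw [div_le_iff₀ hδ]
      have : m / δ / 64 * δ = m / 64 := by field_simp
      linarith
    nlinarith
  have hR5' : (R : ℝ) + 5 ≤ m / δ / 2 := by rwa [div_right_comm] at hR5
  rcases le_or_gt 0 (x i τ - x j τ) with hor | hor
  · -- moving point ABOVE the other one: `x i τ ≥ x j τ + m`; mirror at `c = X j τ + R`, primed estimate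
    rw [abs_of_nonneg hor] at hsep
    obtain ⟨Θ, φ, hφdef, hinv, hφ, hsym, hRP, hsup, hl1, hlev, -⟩ := coordMirror τ (X j τ + R)
    have hφXj : φ (X j) = -(R : ℤ) := by rw [hφdef]; ring
    have h1 : m / δ - 1 ≤ ((X i τ - X j τ : ℤ) : ℝ) := by
      rw [hXi, hXj, latticeApprox_apply, latticeApprox_apply]
      refine le_trans ?_ (sub_div_sub_one_le_floor_sub δ _ _)
      have : m / δ ≤ (x i τ - x j τ) / δ := div_le_div_of_nonneg_right (by linarith) hδ.le
      linarith
    have h2 : (m - h₀) / δ - 1 ≤ ((X' i τ - X j τ : ℤ) : ℝ) := by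
      rw [hXi', hXj, latticeApprox_apply, latticeApprox_apply]
      refine le_trans ?_ (sub_div_sub_one_le_floor_sub δ _ _)
      have hy' : x i τ - h₀ ≤ y τ := by linarith [(abs_le.1 hyτ).1]
      have : (m - h₀) / δ ≤ (y τ - x j τ) / δ := div_le_div_of_nonneg_right (by linarith) hδ.le
      linarith
    have hmh : (m - h₀) / δ = m / δ - h₀ / δ := sub_div _ _ _
    have hh : h₀ / δ ≤ m / δ / 64 := by
      rw [div_le_iff₀ hδ]
      have : m / δ / 64 * δ = m / 64 := by field_simp
      linarith
    have hφXi : 0 ≤ φ (X i) := by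
      have : (0 : ℝ) ≤ ((φ (X i) : ℤ) : ℝ) := by
        rw [hφdef]; push_cast; push_cast at h1; linarith
      exact_mod_cast this
    have hφX'i : 0 ≤ φ (X' i) := by
      have : (0 : ℝ) ≤ ((φ (X' i) : ℤ) : ℝ) := by
        rw [hφdef]; push_cast; push_cast at h2; rw [hmh] at h2; linarith
      exact_mod_cast this
    have hM : 16 * q + 2 * Site.l1Dist (X i) (X' i) ≤ (φ (X i)).natAbs := by
      have hcast : (((φ (X i)).natAbs : ℕ) : ℝ) = ((φ (X i) : ℤ) : ℝ) := by
        rw [Nat.cast_natAbs, Int.cast_abs, abs_of_nonneg (by exact_mod_cast hφXi)]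
      have : (16 * q + 2 * Site.l1Dist (X i) (X' i) : ℝ) ≤ (((φ (X i)).natAbs : ℕ) : ℝ) := by
        rw [hcast, hφdef]; push_cast; push_cast at h1; linarith
      exact_mod_cast this
    have h := MirrorHoelderCompactnessSeparableHoelder.sq_criticalCorr_sub_le' hinv hφ hsym hRP hsup hl1 hlev (n' := 1) i X X' hdiff hφXi hφX'i R
      (fun l hl => by rw [hother l hl, hφXj]) (fun l l' hl hl' hll' => absurd ((hother l hl).trans (hother l' hl').symm) hll')
      hq hM
    rwa [hXi, hXi'] at h
  · -- moving point BELOW the other one: `x j τ ≥ x i τ + m`; mirror at `c = X j τ − R`, unprimed estimate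
    rw [abs_of_neg hor] at hsep
    obtain ⟨Θ, φ, hφdef, hinv, hφ, hsym, hRP, hsup, hl1, hlev, -⟩ := coordMirror τ (X j τ - R)
    have hφXj : φ (X j) = (R : ℤ) := by rw [hφdef]; ring
    have h1 : m / δ - 1 ≤ ((X j τ - X i τ : ℤ) : ℝ) := by
      rw [hXi, hXj, latticeApprox_apply, latticeApprox_apply]
      refine le_trans ?_ (sub_div_sub_one_le_floor_sub δ _ _)
      have : m / δ ≤ (x j τ - x i τ) / δ := div_le_div_of_nonneg_right (by linarith) hδ.le
      linarith
    have h2 : (m - h₀) / δ - 1 ≤ ((X j τ - X' i τ : ℤ) : ℝ) := by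
      rw [hXi', hXj, latticeApprox_apply, latticeApprox_apply]
      refine le_trans ?_ (sub_div_sub_one_le_floor_sub δ _ _)
      have hy' : y τ ≤ x i τ + h₀ := by linarith [(abs_le.1 hyτ).2]
      have : (m - h₀) / δ ≤ (x j τ - y τ) / δ := div_le_div_of_nonneg_right (by linarith) hδ.le
      linarith
    have hmh : (m - h₀) / δ = m / δ - h₀ / δ := sub_div _ _ _
    have hh : h₀ / δ ≤ m / δ / 64 := by
      rw [div_le_iff₀ hδ]
      have : m / δ / 64 * δ = m / 64 := by field_simp
      linarith
    have hφXi : φ (X i) ≤ 0 := by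
      have : ((φ (X i) : ℤ) : ℝ) ≤ 0 := by
        rw [hφdef]; push_cast; push_cast at h1; linarith
      exact_mod_cast this
    have hφX'i : φ (X' i) ≤ 0 := by
      have : ((φ (X' i) : ℤ) : ℝ) ≤ 0 := by
        rw [hφdef]; push_cast; push_cast at h2; rw [hmh] at h2; linarith
      exact_mod_cast this
    have hM : 16 * q + 2 * Site.l1Dist (X i) (X' i) ≤ (φ (X i)).natAbs := by
      have hcast : (((φ (X i)).natAbs : ℕ) : ℝ) = -((φ (X i) : ℤ) : ℝ) := by
        rw [Nat.cast_natAbs, Int.cast_abs, abs_of_nonpos (by exact_mod_cast hφXi)]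
      have : (16 * q + 2 * Site.l1Dist (X i) (X' i) : ℝ) ≤ (((φ (X i)).natAbs : ℕ) : ℝ) := by
        rw [hcast, hφdef]; push_cast; push_cast at h1; linarith
      exact_mod_cast this
    have h := MirrorHoelderCompactnessSeparableHoelder.sq_criticalCorr_sub_le hinv hφ hsym hRP hsup hl1 hlev (n' := 1) i X X' hdiff hφXi hφX'i R
      (fun l hl => by rw [hother l hl, hφXj]) (fun l l' hl hl' hll' => absurd ((hother l hl).trans (hother l' hl').symm) hll')
      hq hM
    rwa [hXi, hXi'] at h

end Summit.CriticalPhenomena.Ising3DConformalLimit.Cruxes.ExistsScaleCovariantLimit.TwoHierarchies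

end
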